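import Literature.Topology.FourManifolds.SmoothEmbeddingCriteria
import Literature.Topology.FourManifolds.RegularDomainMaps
import Literature.Topology.FourManifolds.RegularSublevelSet
import HarnessLib

/-!
# Embeddings of Euclidean space into a regular level

Topic `Literature/Topology/FourManifolds` (fact seat
`provefact-Literature.Topology.FourManifolds.IsHandlebody.exists_isBoundaryGluing_sphere`, step F2b of
the Lickorish–Wallace DAG; data layer of the handle-extension step of the classification of
handlebodies: the feet of a handle as embedded discs in the level below it).  Everything here is
**proved**; no named facts.

Let `f : M → ℝ` be smooth on a manifold with boundary of dimension `k + 1 ≥ 2`, `b` a regular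
value with `{f ≤ b}` in the interior, and present the level `f = b` as the boundary
`V = ∂{f ≤ b}` of the sublevel manifold (`sublevelAtlas`, `RegularSublevelSet.lean`;
`BoundaryManifold.chartedSpace`, `Cobordism.lean`).  A smooth map `e : ℝᵏ → M` with values on
the level lifts to `ℝᵏ → V` (`Literature.Topology.FourManifolds.levelLift`), and:

* `isSmoothEmbedding_levelLift` — if `range e = O ∩ f⁻¹(b)` for an open `O ⊆ M` on which a
  smooth `ℓ : M → ℝᵏ` inverts `e` (`ℓ ∘ e = id`), then the lift is a **smooth embedding** with
  open range `{v | v ∈ O}` (it is a globally defined partial diffeomorphism onto that open set: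
  `isSmoothEmbedding_of_openPartialHomeomorph`, Lee 2013, Prop. 5.2; smoothness into and out of
  `V` by Lee 2013, Cor. 5.30 and Thm. 5.11).

This is how the feet `S⁰ × Dᵏ ↪ ∂W` of a `1`-handle, given in a Morse chart, become embedded
discs of the level manifold (Milnor, *Lectures on the h-cobordism theorem* (1965), proof of
Thm. 3.13: "the images of these disks under the trajectories").

## References

* J. M. Lee, *Introduction to Smooth Manifolds*, 2nd ed. (2013), Prop. 5.2, Thm. 5.11,
  Cor. 5.30. [LeeSmoothManifolds2013]
* J. Milnor, *Lectures on the h-cobordism theorem* (1965), proof of Thm. 3.13. [MilnorHCobordism1965]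
-/

open scoped Manifold ContDiff Topology
open Set Function Filter Metric

noncomputable section

namespace Literature.Topology.FourManifolds

universe u

/-- Local notation: `𝔼 m` is the model Euclidean space `EuclideanSpace ℝ (Fin m)`. -/
local notation "𝔼 " m:arg => EuclideanSpace ℝ (Fin m)

variable {k : ℕ} {M : Type u} [TopologicalSpace M] [ChartedSpace (EuclideanHalfSpace (k + 1)) M]
  [IsManifold (𝓡∂ (k + 1)) ∞ M]
  {f : M → ℝ} {hf : ContMDiff (𝓡∂ (k + 1)) 𝓘(ℝ, ℝ) ∞ f} {b : ℝ}
  {hint : ∀ p, f p ≤ b → (𝓡∂ (k + 1)).IsInteriorPoint p}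
  {hreg : ∀ p, f p = b → ¬ IsMCriticalPt (𝓡∂ (k + 1)) f p}
  [csW : ChartedSpace (EuclideanHalfSpace (k + 1)) ↥(f ⁻¹' Iic b)]

/-- **Lift of a map with values on the level `f = b` to the level manifold `∂{f ≤ b}`.** [folklore] -/
def levelLift (hcs : csW = (sublevelAtlas hf b hint hreg).chartedSpace) {N : Type*} (e : N → M)
    (heb : ∀ w, f (e w) = b) (w : N) : ↥((𝓡∂ (k + 1)).boundary ↥(f ⁻¹' Iic b)) :=
  ⟨⟨e w, (heb w).le⟩, by subst hcs; exact (isBoundaryPoint_sublevel_iff hf b hint hreg ⟨e w, (heb w).le⟩).2 (heb w)⟩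

variable (hcs : csW = (sublevelAtlas hf b hint hreg).chartedSpace)

/-- The underlying point of the lift. [folklore] -/
@[simp] theorem levelLift_val {N : Type*} (e : N → M) (heb : ∀ w, f (e w) = b) (w : N) :
    ((levelLift hcs e heb w : ↥(f ⁻¹' Iic b)) : M) = e w := rfl

include hcs in
/-- Points of `∂{f ≤ b}` lie on the level. [folklore] -/
theorem apply_coe_coe_eq (v : ↥((𝓡∂ (k + 1)).boundary ↥(f ⁻¹' Iic b))) : f ((v : ↥(f ⁻¹' Iic b)) : M) = b := by
  subst hcs; exact (isBoundaryPoint_sublevel_iff hf b hint hreg v.1).1 v.2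

/-- **The lift of a smooth map is smooth** (Lee 2013, Cor. 5.30, twice). [cite: LeeSmoothManifolds2013, Cor. 5.30] -/
theorem contMDiffAt_levelLift [IsManifold (𝓡∂ (k + 1)) ∞ ↥(f ⁻¹' Iic b)]
    {E' H' : Type*} [NormedAddCommGroup E'] [NormedSpace ℝ E'] [TopologicalSpace H']
    {J : ModelWithCorners ℝ E' H'} {N : Type*} [TopologicalSpace N] [ChartedSpace H' N]
    {e : N → M} (heb : ∀ w, f (e w) = b) {w : N} (he : ContMDiffAt J (𝓡∂ (k + 1)) ∞ e w) :
    ContMDiffAt J (𝓡 k) ∞ (levelLift hcs e heb) w := by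
  have h1 : ContMDiffAt J (𝓡∂ (k + 1)) ∞ ((f ⁻¹' Iic b).codRestrict e fun w => (heb w).le) w := by
    subst hcs
    letI := (sublevelAtlas hf b hint hreg).chartedSpace
    exact (sublevelAtlas hf b hint hreg).contMDiffAt_codRestrict (fun w => (heb w).le) he
  have h2 := BoundaryManifold.contMDiffAt_codRestrict (g := (f ⁻¹' Iic b).codRestrict e fun w => (heb w).le)
    (fun w => (levelLift hcs e heb w).2) h1
  exact h2

/-- **Lifts of embedded level discs are smooth embeddings of the level manifold.**  Let
`e : ℝᵏ → M` be smooth with `f ∘ e = b`, `range e = O ∩ f⁻¹(b)` for an open `O`, and let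
`ℓ : M → ℝᵏ` be smooth on `O` with `ℓ ∘ e = id`.  Then `levelLift e : ℝᵏ → ∂{f ≤ b}` is a smooth
embedding, and its range is the open set `{v | v ∈ O}` (dimension `k ≥ 1`).
[cite: LeeSmoothManifolds2013, Prop. 5.2] -/
theorem isSmoothEmbedding_levelLift [IsManifold (𝓡∂ (k + 1)) ∞ ↥(f ⁻¹' Iic b)] (hk : 1 ≤ k)
    {e : 𝔼 k → M} (he : ContMDiff 𝓘(ℝ, 𝔼 k) (𝓡∂ (k + 1)) ∞ e) (heb : ∀ w, f (e w) = b)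
    {O : Set M} (hO : IsOpen O) (hrange : range e = O ∩ f ⁻¹' {b})
    {ℓ : M → 𝔼 k} (hℓ : ContMDiffOn (𝓡∂ (k + 1)) 𝓘(ℝ, 𝔼 k) ∞ ℓ O) (hℓe : ∀ w, ℓ (e w) = w) :
    Manifold.IsSmoothEmbedding 𝓘(ℝ, 𝔼 k) (𝓡 k) ∞ (levelLift hcs e heb) ∧
      range (levelLift hcs e heb) = {v : ↥((𝓡∂ (k + 1)).boundary ↥(f ⁻¹' Iic b)) | ((v : ↥(f ⁻¹' Iic b)) : M) ∈ O} ∧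
      IsOpen {v : ↥((𝓡∂ (k + 1)).boundary ↥(f ⁻¹' Iic b)) | ((v : ↥(f ⁻¹' Iic b)) : M) ∈ O} := by
  have heO : ∀ w, e w ∈ O := fun w => by
    have : e w ∈ range e := mem_range_self w
    rw [hrange] at this; exact this.1
  have hcont2 : Continuous fun v : ↥((𝓡∂ (k + 1)).boundary ↥(f ⁻¹' Iic b)) => ((v : ↥(f ⁻¹' Iic b)) : M) :=
    continuous_subtype_val.comp continuous_subtype_val
  have hTo : IsOpen {v : ↥((𝓡∂ (k + 1)).boundary ↥(f ⁻¹' Iic b)) | ((v : ↥(f ⁻¹' Iic b)) : M) ∈ O} :=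
    hO.preimage hcont2
  -- points of the target come from `e`
  have hsurj : ∀ v : ↥((𝓡∂ (k + 1)).boundary ↥(f ⁻¹' Iic b)), ((v : ↥(f ⁻¹' Iic b)) : M) ∈ O →
      e (ℓ ((v : ↥(f ⁻¹' Iic b)) : M)) = ((v : ↥(f ⁻¹' Iic b)) : M) := by
    intro v hv
    have hmem : ((v : ↥(f ⁻¹' Iic b)) : M) ∈ range e := by
      rw [hrange]; exact ⟨hv, apply_coe_coe_eq hcs v⟩
    obtain ⟨w, hw⟩ := hmem
    rw [← hw, hℓe]
  -- the partial homeomorphism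
  set Φ : OpenPartialHomeomorph (𝔼 k) ↥((𝓡∂ (k + 1)).boundary ↥(f ⁻¹' Iic b)) :=
    { toFun := levelLift hcs e heb
      invFun := fun v => ℓ ((v : ↥(f ⁻¹' Iic b)) : M)
      source := univ
      target := {v | ((v : ↥(f ⁻¹' Iic b)) : M) ∈ O}
      map_source' := fun w _ => heO w
      map_target' := fun _ _ => mem_univ _
      left_inv' := fun w _ => hℓe w
      right_inv' := fun v hv => by
        apply Subtype.ext; apply Subtype.ext
        simp only [levelLift_val]
        exact hsurj v hv
      open_source := isOpen_univ
      open_target := hTo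
      continuousOn_toFun := by
        refine Continuous.continuousOn ?_
        exact (he.continuous.subtype_mk _).subtype_mk _
      continuousOn_invFun := hℓ.continuousOn.comp hcont2.continuousOn fun v hv => hv } with hΦ
  have hΦsm : ContMDiffOn 𝓘(ℝ, 𝔼 k) (𝓡 k) ∞ Φ Φ.source := fun w _ =>
    (contMDiffAt_levelLift hcs heb he.contMDiffAt).contMDiffWithinAt
  have hΦsm' : ContMDiffOn (𝓡 k) 𝓘(ℝ, 𝔼 k) ∞ Φ.symm Φ.target := by
    intro v hv
    apply ContMDiffAt.contMDiffWithinAt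
    have hv' : ((v : ↥(f ⁻¹' Iic b)) : M) ∈ O := hv
    have h1 : ContMDiffAt (𝓡∂ (k + 1)) 𝓘(ℝ, 𝔼 k) ∞ (ℓ ∘ Subtype.val : ↥(f ⁻¹' Iic b) → 𝔼 k) (v : ↥(f ⁻¹' Iic b)) := by
      refine (hℓ.contMDiffAt (hO.mem_nhds hv')).comp _ ?_
      subst hcs
      letI := (sublevelAtlas hf b hint hreg).chartedSpace
      exact ((sublevelAtlas hf b hint hreg).contMDiff_subtype_val hk).contMDiffAt
    exact BoundaryManifold.contMDiffAt_comp_val h1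
  have hemb := isSmoothEmbedding_of_openPartialHomeomorph (I := 𝓘(ℝ, 𝔼 k)) (J := 𝓡 k) Φ rfl hΦsm hΦsm'
    (ContinuousLinearEquiv.refl ℝ (𝔼 k))
  refine ⟨hemb, ?_, hTo⟩
  apply Set.ext
  intro v
  simp only [mem_range, mem_setOf_eq]
  constructor
  · rintro ⟨w, hw⟩; rw [← hw]; exact heO w
  · intro hv
    exact ⟨ℓ ((v : ↥(f ⁻¹' Iic b)) : M), by
      apply Subtype.ext; apply Subtype.ext; simp only [levelLift_val]; exact hsurj v hv⟩

end Literature.Topology.FourManifolds
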